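import Mathlib

/-!
# Parabola-free sets of `ℤ_p²`: the certified instances `α₇ ≥ 10`, `α₁₁ ≥ 23`
(stub `stub_tangencySets` of the crux `LevelOneGL2Designs`, stmt-MatrixMultiplication-14080;
wall-breaker axis 5/12, *parabola lifts over finite fields*)

A set `T ⊆ ℤ_p × ℤ_p` is PARABOLA-FREE when no two of its points differ by `(r, ±r²)` with
`r ≠ 0`; equivalently (the planner's hypothesis shape, that of the wallb lemma
`tangency_of_parabolaFree`) `∀ t t' ∈ T, (t'.1 − t.1)² = t.2 − t'.2 → t'.1 = t.1`.  These are exactly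
the index sets `I` for which the parabola lift `{(x, x² + c) : (x, c) ∈ I}` of `AG(2,p)`, each point
with the tangent of its own parabola, is a tangency set (family "P2-mod" of
`Cruxes/LevelOneGL2Designs/DECOMPOSITIONS.md`: parabola lifts WITH wrap-around, the one member of the
parabola-lift family whose asymptotics are open).  `α_p` denotes the largest size.

This file proves the two lower-bound instance stubs registered by the siege planner,
`stub_parabolaFreeAt_7_10` (`α₇ ≥ 10`) and `stub_parabolaFreeAt_11_23` (`α₁₁ ≥ 23`), by exhibiting the
witnesses and letting the kernel decide the (finite) defining property.  The matching upper bounds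
`α₇ ≤ 10`, `α₁₁ ≤ 23` (exactness) are the subject of the companion file
`…ParabolaFreeExact.lean` (verified branch and bound).  Exact values known to this seat
(kit/pfree, column branch-and-bound with translation and dilation symmetry):
`α₅ = 10`, `α₇ = 10`, `α₁₁ = 23`, `α₁₃ = 39 = 3·13` (the Paley pencil `ℤ₁₃ × {0,2,7}` is optimal).
-/

set_option linter.dupNamespace false -- `MatrixMultiplication.MatrixMultiplication` (summit = problem, D-0017)

namespace Summit.MatrixMultiplication.MatrixMultiplication.Theorems.LevelOneGL2Designs.ParabolaFree

/-- **Instance stub `stub_parabolaFreeAt_7_10`** (planner, wall-plan): `ℤ₇²` contains a parabola-free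
set of 10 points, namely `{(0,0),(1,3),(1,4),(4,3),(4,4),(5,0),(6,2),(6,3),(6,4),(6,5)}` (so `α₇ ≥ 10`;
with `α₇ ≤ 10` of the companion file, `α₇ = 10 < ⌊7^{3/2}⌋ = 18`). [computation, kernel `decide`] -/
theorem stub_parabolaFreeAt_7_10 : ∃ T : Finset (ZMod 7 × ZMod 7), 10 ≤ T.card ∧
    ∀ t ∈ T, ∀ t' ∈ T, (t'.1 - t.1) ^ 2 = t.2 - t'.2 → t'.1 = t.1 :=
  ⟨{(0, 0), (1, 3), (1, 4), (4, 3), (4, 4), (5, 0), (6, 2), (6, 3), (6, 4), (6, 5)},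
    by decide +kernel⟩

/-- **Instance stub `stub_parabolaFreeAt_11_23`** (planner, wall-plan): `ℤ₁₁²` contains a
parabola-free set of 23 points (seven consecutive columns `x = −4, …, 2` carrying `c`-intervals of
lengths `2,3,4,5,4,3,2` — a wrapped, thickened parabola; so `α₁₁ ≥ 23 = 2·11 + 1`, more than any
parabola PENCIL `ℤ₁₁ × C` can give since `11 ≡ 3 (mod 4)` forces `|C| ≤ 1`).
[computation, kernel `decide`] -/
theorem stub_parabolaFreeAt_11_23 : ∃ T : Finset (ZMod 11 × ZMod 11), 23 ≤ T.card ∧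
    ∀ t ∈ T, ∀ t' ∈ T, (t'.1 - t.1) ^ 2 = t.2 - t'.2 → t'.1 = t.1 :=
  ⟨{(0, 0), (0, 1), (0, 2), (0, 3), (1, 6), (1, 7), (1, 8), (2, 1), (2, 2), (7, 1), (7, 2),
    (8, 6), (8, 7), (8, 8), (9, 0), (9, 1), (9, 2), (9, 3), (10, 5), (10, 6), (10, 7), (10, 8),
    (10, 9)},
    by decide +kernel⟩

end Summit.MatrixMultiplication.MatrixMultiplication.Theorems.LevelOneGL2Designs.ParabolaFree
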